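import Mathlib
import Summits.Ventures.HodgeRepro2.T5LocalNormIndex
import Summits.Ventures.HodgeRepro2.T6N5TateTwist
import Summits.Ventures.HodgeRepro2.T6N5Hyp
import Summits.Ventures.HodgeRepro2.T6N5LocalDatum
import Summits.Ventures.HodgeRepro2.T6N5LocalHyp
import Summits.Ventures.HodgeRepro2.T6N5Local
import Summits.Ventures.HodgeRepro2.T6N5LocalWeil
import Summits.Ventures.HodgeRepro2.T6N5LocalCharDatum
import Summits.Ventures.HodgeRepro2.T6N5LocalInertHyp
import Summits.Ventures.HodgeRepro2.T6N5LocalInertWeil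
import Summits.Ventures.HodgeRepro2.T6N5LocalRamHyp
import Summits.Ventures.HodgeRepro2.T6N5LocalRamWeil
import Summits.Ventures.HodgeRepro2.T6N5LocalInertCompletion
import Summits.Ventures.HodgeRepro2.T6N5LocalInertOnCompletion
import Summits.Ventures.HodgeRepro2.T6N5LocalRamOnCompletion
import Summits.Ventures.HodgeRepro2.T6N5LocalTateChars
import Summits.Ventures.HodgeRepro2.T6N5LocalInertTateSide
import Summits.Ventures.HodgeRepro2.T6N5LocalRamTateSide
import Summits.Ventures.HodgeRepro2.T6N5LocalOnCompletionWeil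

/-!
# T6N5LocalWeilQuotient — Tier 6, M2 sub-step N5 (t6-p8's half): the compact group `U(V) = E¹_v` as the quotient
`E_v^×/F_v^×`, so that «`j(F_v^×) = 1`» is a theorem

`T6N5LocalOnCompletionWeil` takes the carried Weil representations over an abstract compact abelian group `A` with
`ofOne : AddChar A ℂ → (E →* ℂˣ)` (`α ↦ α_K = α ∘ j`) and the datum condition `hofOne : ∀ α, α_K conjugate-orthogonal`
(«`j` kills `F_v^×`», Borade §3.3.1: `j : E_v^× → E¹_v`, `x ↦ x/x̄`, is trivial on `F_v^×`, and by Hilbert 90 it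
identifies `E_v^×/F_v^×` with `E¹_v`). Here `A := E_v^×/F_v^×` written additively (`QuotA`), `ofOne` := inflation
through the quotient map (`ofOneQ`), and `hofOne` is PROVED (`ofOneQ_mem_Fsub`, `isCO_ofOneQ_inert` / `_ram`):
the per-place statements of record lose the binder `hofOne` —
`N5Local_main_inert_completion_weil'` / `N5Local_main_ram_completion_weil'`: hypotheses = the place data, `ψ_δ`, the
three printed displays on the ε-factor parameter, the Weil representations' non-vanishing and smoothness, `ϵ_δ(W) = 1`
and `χ_W` conjugate-symplectic.
README §8(d): uses an L-value-free non-vanishing device: NO.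
-/

namespace Summit.Ventures.HodgeRepro2.T6.N5LocalWeilQuotient

open Summit.Ventures.HodgeRepro2 IsDedekindDomain HeightOneSpectrum
  Summit.Ventures.HodgeRepro2.T6.N5LocalDatum Summit.Ventures.HodgeRepro2.T6.N5LocalWeil
  Summit.Ventures.HodgeRepro2.T6.N5LocalCharDatum Summit.Ventures.HodgeRepro2.T6.N5Local
  Summit.Ventures.HodgeRepro2.T6.N5LocalInertWeil Summit.Ventures.HodgeRepro2.T6.N5LocalRamWeil
  Summit.Ventures.HodgeRepro2.T6.Hyp Summit.Ventures.HodgeRepro2.T6.N5LocalInertCompletion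
  Summit.Ventures.HodgeRepro2.T6.N5LocalInertOnCompletion Summit.Ventures.HodgeRepro2.T6.N5LocalRamOnCompletion
  Summit.Ventures.HodgeRepro2.T6.N5LocalTateChars Summit.Ventures.HodgeRepro2.T6.N5LocalInertTateSide
  Summit.Ventures.HodgeRepro2.T6.N5LocalRamTateSide Summit.Ventures.HodgeRepro2.T6.N5LocalOnCompletionWeil

-- `K`, `L` in `Type` (universe `0`).
variable {K : Type} [Field K] [NumberField K] (v : HeightOneSpectrum (NumberField.RingOfIntegers K))
  {L : Type} [Field L] [NumberField L] [Algebra K L] (w : HeightOneSpectrum (NumberField.RingOfIntegers L))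
  [w.asIdeal.LiesOver v.asIdeal]
  [ContinuousSMul (v.adicCompletion K) (w.adicCompletion L)]
  [IsScalarTower K (v.adicCompletion K) (w.adicCompletion L)]

noncomputable section

/-- `U(V) = E¹_v` as the quotient `E_v^×/F_v^×` (Hilbert 90 through `j : x ↦ x/x̄`), written additively. -/
abbrev QuotA : Type := Additive ((w.adicCompletion L)ˣ ⧸ Fsub v w)

omit [ContinuousSMul (v.adicCompletion K) (w.adicCompletion L)]
  [IsScalarTower K (v.adicCompletion K) (w.adicCompletion L)] in
/-- The quotient map `E_v^× → E_v^×/F_v^×`, landing in `Multiplicative (QuotA)` (the type tags are identities). -/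
def toMulAdd : (w.adicCompletion L)ˣ →* Multiplicative (QuotA v w) where
  toFun x := Multiplicative.ofAdd (Additive.ofMul (x : (w.adicCompletion L)ˣ ⧸ Fsub v w))
  map_one' := rfl
  map_mul' _ _ := rfl

omit [ContinuousSMul (v.adicCompletion K) (w.adicCompletion L)]
  [IsScalarTower K (v.adicCompletion K) (w.adicCompletion L)] in
/-- `α ↦ α_K = α ∘ j`: a character of `E_v^×/F_v^×` read as a character of `E_v^×` through the quotient map. -/
def ofOneQ (α : AddChar (QuotA v w) ℂ) : (w.adicCompletion L)ˣ →* ℂˣ where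
  toFun x := α.toMonoidHom.toHomUnits (toMulAdd v w x)
  map_one' := by rw [map_one, map_one]
  map_mul' x y := by rw [map_mul, map_mul]

omit [ContinuousSMul (v.adicCompletion K) (w.adicCompletion L)]
  [IsScalarTower K (v.adicCompletion K) (w.adicCompletion L)] in
/-- The value of `α_K`. -/
theorem ofOneQ_apply (α : AddChar (QuotA v w) ℂ) (x : (w.adicCompletion L)ˣ) :
    ((ofOneQ v w α x : ℂˣ) : ℂ) = α (Additive.ofMul (x : (w.adicCompletion L)ˣ ⧸ Fsub v w)) := by
  simp [ofOneQ, toMulAdd, MonoidHom.coe_toHomUnits]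

omit [ContinuousSMul (v.adicCompletion K) (w.adicCompletion L)]
  [IsScalarTower K (v.adicCompletion K) (w.adicCompletion L)] in
/-- `j(F_v^×) = 1`: every `α_K` is trivial on `F_v^×`. -/
theorem ofOneQ_mem_Fsub (α : AddChar (QuotA v w) ℂ) (f : Fsub v w) : ofOneQ v w α f = 1 := by
  apply Units.ext
  rw [ofOneQ_apply, Units.val_one, (QuotientGroup.eq_one_iff _).mpr f.2, ofMul_one, AddChar.map_zero_eq_one]

/-- The carried Weil representations of the two hermitian lines over `E_v^×/F_v^×` (data only). -/
structure WeilRep where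
  /-- the space of the Weil representation of the line `V_s` restricted to `U(V_s)`. -/
  Wsp : ℤˣ → Type
  [instW : ∀ s, AddCommGroup (Wsp s)]
  [instWm : ∀ s, Module ℂ (Wsp s)]
  /-- the Weil representation `ω_{V_s,W,ι̃,ψ}` restricted to `U(V_s) = E¹_v = E_v^×/F_v^×`. -/
  ωWeil : ∀ s, Representation ℂ (Multiplicative (QuotA v w)) (Wsp s)

attribute [instance] WeilRep.instW WeilRep.instWm

/-- The Weil carrier of `T6N5LocalOnCompletionWeil` with `A := E_v^×/F_v^×` and `ofOne := ofOneQ`. -/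
abbrev toCarrier (R : WeilRep v w) : WeilCarrier (w.adicCompletion L)ˣ where
  A := QuotA v w
  Wsp := R.Wsp
  ωWeil := R.ωWeil
  ofOne := ofOneQ v w

/-! ### Inert places -/

section Inert

variable (h2 : Module.finrank (v.adicCompletion K) (w.adicCompletion L) = 2)
  {ϖ : v.adicCompletionIntegers K} (hϖ : Irreducible ϖ)
  (hϖS : Irreducible (algebraMap (v.adicCompletionIntegers K) (w.adicCompletionIntegers L) ϖ))
  (σ : Gal(w.adicCompletion L/v.adicCompletion K)) (hσ : σ ≠ 1)
  (P : TateParams (w.adicCompletion L)ˣ (PsiC w) ℝ) (ψδ : PsiC w)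
  (hK : ∀ a : v.adicCompletion K, ψδ.1 (algebraMap (v.adicCompletion K) (w.adicCompletion L) a) = 1)
  (R : WeilRep v w)

omit [IsScalarTower K (v.adicCompletion K) (w.adicCompletion L)] in
/-- `hofOne` at an inert place: every `α_K` is conjugate-orthogonal. -/
theorem isCO_ofOneQ_inert (α : AddChar (QuotA v w) ℂ) :
    (mkInertWeil v w h2 hϖ hϖS σ hσ P ψδ hK (toCarrier v w R)).toWeil.toLocalSignDatum.IsCO (ofOneQ v w α) := by
  show (mkInert v w ϖ σ (T5LocalNormIndex.index_normGroup_eq_two v w σ h2 hσ)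
    (mkTateSide v w h2 hϖ hϖS σ hσ P ψδ hK)).toLocalSignDatum.IsCO (ofOneQ v w α)
  exact (CharDatum.isCO_iff _ _).mpr fun x => ofOneQ_mem_Fsub v w α x

/-- THEOREM N5.T2 AT AN INERT PLACE with `U(V) = E_v^×/F_v^×`: `N5Local_main_inert_completion_weil` with `hofOne`
discharged. Hypotheses: the place data, `ψ_δ`, the displays `hG` / `hT` / `h35`, the Weil representations'
smoothness and non-vanishing, `ϵ_δ(W) = 1`, `χ_W` conjugate-symplectic. -/
theorem N5Local_main_inert_completion_weil'
    (hf : 2 ≤ (Ideal.span {ϖ}).inertiaDeg'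
      (Ideal.span {algebraMap (v.adicCompletionIntegers K) (w.adicCompletionIntegers L) ϖ}))
    (hG : GGP2012ex_Prop3_1 (mkInertWeil v w h2 hϖ hϖS σ hσ P ψδ hK (toCarrier v w R)).D)
    (hT : Tate1979_3_2_2_3 P.epsT (fun ξ a => ((ξ a : ℂˣ) : ℂ)) (twist w) (fun r m => r * m) (nrm w)
      (fun _ => True))
    (h35 : BFGYYZ2025_Thm3_5
      (mkInertWeil v w h2 hϖ hϖS σ hσ P ψδ hK (toCarrier v w R)).toWeil.toLocalSignDatum)
    (hsm : ∀ s, (mkInertWeil v w h2 hϖ hϖS σ hσ P ψδ hK (toCarrier v w R)).toWeil.IsSmoothCompact s)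
    [∀ s, Nontrivial (R.Wsp s)]
    (hW : P.epsdW = 1)
    (hχW : (mkInertWeil v w h2 hϖ hϖS σ hσ P ψδ hK (toCarrier v w R)).toWeil.toLocalSignDatum.IsCS P.χW) :
    ∃ ξ : Fin 4 → (w.adicCompletion L)ˣ →* ℂˣ,
      LocalSolution (mkInertWeil v w h2 hϖ hϖS σ hσ P ψδ hK (toCarrier v w R)).toWeil.toLocalSignDatum ξ :=
  N5Local_main_inert_completion_weil v w h2 hϖ hϖS σ hσ P ψδ hK (toCarrier v w R) hf hG hT h35 hsm
    (isCO_ofOneQ_inert v w h2 hϖ hϖS σ hσ P ψδ hK R) hW hχW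

end Inert

/-! ### Ramified places (tame or wild) -/

section Ram

variable (h2 : Module.finrank (v.adicCompletion K) (w.adicCompletion L) = 2)
  {ϖ : v.adicCompletionIntegers K} (hϖ : Irreducible ϖ) {π : w.adicCompletionIntegers L} (hπ : Irreducible π)
  (hram : ¬ Irreducible (algebraMap (v.adicCompletionIntegers K) (w.adicCompletionIntegers L) ϖ))
  (σ : Gal(w.adicCompletion L/v.adicCompletion K)) (hσ : σ ≠ 1)
  (P : TateParams (w.adicCompletion L)ˣ (PsiC w) ℝ) (ψδ : PsiC w)
  (R : WeilRep v w)

omit [ContinuousSMul (v.adicCompletion K) (w.adicCompletion L)]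
  [IsScalarTower K (v.adicCompletion K) (w.adicCompletion L)] in
/-- `hofOne` at a ramified place: every `α_K` is conjugate-orthogonal. -/
theorem isCO_ofOneQ_ram (α : AddChar (QuotA v w) ℂ) :
    (mkRamWeil v w h2 hπ σ hσ P ψδ (toCarrier v w R)).toWeil.toLocalSignDatum.IsCO (ofOneQ v w α) := by
  show (mkRam v w hπ σ (T5LocalNormIndex.index_normGroup_eq_two v w σ h2 hσ)
    (mkTateSideRam v w σ P ψδ)).toLocalSignDatum.IsCO (ofOneQ v w α)
  exact (CharDatum.isCO_iff _ _).mpr fun x => ofOneQ_mem_Fsub v w α x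

include hϖ hram in
/-- THEOREM N5.T2 AT EVERY FINITE RAMIFIED PLACE (tame or wild) with `U(V) = E_v^×/F_v^×`:
`N5Local_main_ram_completion_weil` with `hofOne` discharged. -/
theorem N5Local_main_ram_completion_weil'
    (hK : ∀ a : v.adicCompletion K, ψδ.1 (algebraMap (v.adicCompletion K) (w.adicCompletion L) a) = 1)
    (hT6 : Tate1979_3_2_6_3 (mkRamWeil v w h2 hπ σ hσ P ψδ (toCarrier v w R)).D)
    (hG : GGP2012_Prop5_1_2 (mkRamWeil v w h2 hπ σ hσ P ψδ (toCarrier v w R)).D)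
    (h35 : BFGYYZ2025_Thm3_5 (mkRamWeil v w h2 hπ σ hσ P ψδ (toCarrier v w R)).toWeil.toLocalSignDatum)
    (hsm : ∀ s, (mkRamWeil v w h2 hπ σ hσ P ψδ (toCarrier v w R)).toWeil.IsSmoothCompact s)
    [∀ s, Nontrivial (R.Wsp s)]
    (hW : P.epsdW = 1)
    (hχW : (mkRamWeil v w h2 hπ σ hσ P ψδ (toCarrier v w R)).toWeil.toLocalSignDatum.IsCS P.χW) :
    ∃ ξ : Fin 4 → (w.adicCompletion L)ˣ →* ℂˣ,
      LocalSolution (mkRamWeil v w h2 hπ σ hσ P ψδ (toCarrier v w R)).toWeil.toLocalSignDatum ξ :=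
  N5Local_main_ram_completion_weil v w h2 hϖ hπ hram σ hσ P ψδ (toCarrier v w R) hK hT6 hG h35 hsm
    (isCO_ofOneQ_ram v w h2 hπ σ hσ P ψδ R) hW hχW

end Ram

end

end Summit.Ventures.HodgeRepro2.T6.N5LocalWeilQuotient
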